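import Mathlib
import Summits.ResolutionOfSingularities.ResolutionOfSingularities.Theorems.RadicialJungCleanModelsCleanProp44TransformNormalForm
import Summits.ResolutionOfSingularities.ResolutionOfSingularities.Theorems.RadicialJungCleanModelsCleanProp44NearLineLocal
import HarnessLib

/-!
# Route `RadicialJung`, crux `CleanModels` (stmt-ResolutionOfSingularities-15917), line `Sketch` rev 35, stub 6 `stub_cleanProp44` (X44c):
# CLEAN-PERMISSIBILITY OF NEAR LINES, III — at the points of an actual blowing up (scheme level)

Seat decomp-res-hand-2 g18 (structural hand).  Lemma (ii) of hand-2 g17's census of the Phase II residual (R1ᵐⁱⁿ)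
(`Cruxes/CleanModels/Lines/Sketch-memo-hand2-g17-stubs-5-7.md` §2 (a)) AT SCHEME LEVEL: the normal form of the transform
(✓ `exists_transform_normalForm_of_isBlowup`, `…CleanProp44TransformNormalForm.lean`) combined with the local dictionary
(✓ `…CleanProp44NearLineLocal.lean`).  Setting: `τ : X' → X` a blowing up along `J` (`IsBlowup`), `x' ∈ X'` over `x = τ x'`, the line of `G`
CLEAN-PERMISSIBLE at `x` for `J_x` in its form-(1) currency — a regular system of parameters `(c, w)` of `𝒪_{X,x}` with `(c) = J_x` and a
non-trivial representative `Σ c_j^p G^j = u · ∏ c_k^{a_k} · ∏ w_m^{b_m}` —, `dim 𝒪_{X',x'} = 3`, and a regular curve germ THROUGH `x'` INSIDE THE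
EXCEPTIONAL DIVISOR: `N = (e', z)` with `(e') = J_x 𝒪_{X',x'}` and `(e', z, z')` a regular system of parameters of `𝒪_{X',x'}` (for a near line
`ℓ = cl{η'}` over a `τ = 1` point this is ✓ `CP2008Prop44.stalkIdeal_vanishingIdeal_closure_eq_span_pair_of_adapted`: `𝓘_{ℓ,x'} = (y', φ u)`).
A clean SIDE `V(c_k)` (`a_k ≠ 0`) «does not pass through `x'`» iff `(τ^♯ c_k) = J_x 𝒪_{X',x'}` (its strict transform is a unit at `x'`).  PROVED:

* `cleanPermissibleAt_exceptionalCurve_of_not_dvd` — NO side through `x'`, `p ∤ A = Σ a_k` (charged plane; memo 4e §2.4 (B1)): `N` is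
  clean-permissible, whatever `z`.
* `cleanPermissibleAt_exceptionalCurve_of_nonbirth` — NO side through `x'`, any `A`: `N` is clean-permissible as soon as `x'` is NOT A BIRTH of `N`
  for the unit `U` presenting the transform as `U · e'^A` (the three-way non-birth condition of ✓ `cleanPermissibleAt_of_unit_rep`, asked for every
  such presentation).
* (sequel `…CleanProp44NearLineSchemeSide.lean`: exactly ONE side through `x'`, contained in `N` or transversal to `N`.)
* `eq_zero_of_span_centre_eq_maximalIdeal` — bookkeeping for POINT centres (`J_x = 𝔪_x` forces `l = 0`, so the `w`-hypotheses are void).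

Left to the consumer (the honest residue, finite on each near line): corners of the clean divisor met by `N` in a non-axis direction
(✓ `not_cleanPermissibleAt_diagonal_cornerWitness`), sides TANGENT to `N` (contact order; ✓ `…CleanPermissibleContactOrder.lean`), and births
(✓ `not_cleanPermissibleAt_of_derivations`); `w`-sides (curve centres, memo 4e (B3)/(B4)) are excluded here by `b = 0`.

Honest framing: OURS; a TOOL for the (R1ᵐⁱⁿ)/(R3ᵐⁱⁿ′) provers.  Nothing here proves X44c, any case of `CleanModels`, or resolution of
singularities in characteristic `p`.  Setting only: [cite: Piltant2013, §2 Axiom 4] [cite: CossartPiltant2008, Lemma 4.3 (5)]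
[cite: GortzWedhorn2020, Prop. 13.91] [cite: DeJong1996, 2.4].
-/

noncomputable section

set_option linter.dupNamespace false -- mandated namespace of this single-conjunct summit

open IsLocalRing CategoryTheory AlgebraicGeometry
open Literature.AlgebraicGeometry.Resolution Literature.AlgebraicGeometry.Motives

namespace Summit.ResolutionOfSingularities.ResolutionOfSingularities.Theorems.RadicialJung.CleanModels

universe u

/-! ## §0 Local plumbing -/

section Plumbing

variable {R : Type u} [CommRing R]

/-- Replacing the first generator of a pair by `r = α a + β b` with `α` a unit does not change the span. [folklore] -/
theorem nearLine_span_pair_eq_of_isUnit {a b r α β : R} (hα : IsUnit α) (hr : r = α * a + β * b) :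
    Ideal.span ({r, b} : Set R) = Ideal.span {a, b} := by
  obtain ⟨v, rfl⟩ := hα
  apply le_antisymm
  · rw [Ideal.span_le, Set.insert_subset_iff, Set.singleton_subset_iff]
    refine ⟨?_, Ideal.subset_span (by simp)⟩
    rw [SetLike.mem_coe, hr]
    exact Ideal.add_mem _ (Ideal.mul_mem_left _ _ (Ideal.subset_span (by simp))) (Ideal.mul_mem_left _ _ (Ideal.subset_span (by simp)))
  · rw [Ideal.span_le, Set.insert_subset_iff, Set.singleton_subset_iff]
    refine ⟨?_, Ideal.subset_span (by simp)⟩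
    have ha : a = ↑v⁻¹ * (r - β * b) := by
      rw [hr, add_sub_cancel_right, ← mul_assoc, Units.inv_mul, one_mul]
    rw [SetLike.mem_coe, ha]
    exact Ideal.mul_mem_left _ _ (Ideal.sub_mem _ (Ideal.subset_span (by simp)) (Ideal.mul_mem_left _ _ (Ideal.subset_span (by simp))))

/-- Replacing the first generator of a triple by `r = α a + β b` with `α` a unit does not change the span. [folklore] -/
theorem nearLine_span_triple_eq_of_isUnit {a b c r α β : R} (hα : IsUnit α) (hr : r = α * a + β * b) :
    Ideal.span ({r, b, c} : Set R) = Ideal.span {a, b, c} := by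
  have h2 := nearLine_span_pair_eq_of_isUnit (a := a) (b := b) hα hr
  have key : ∀ (x y : R) (t : R), Ideal.span ({x, y, t} : Set R) = Ideal.span {x, y} ⊔ Ideal.span {t} := by
    intro x y t
    have hset : ({x, y, t} : Set R) = {x, y} ∪ {t} := by
      ext b'
      simp only [Set.mem_insert_iff, Set.mem_singleton_iff, Set.mem_union]
      tauto
    rw [hset, Ideal.span_union]
  rw [key, key, h2]

/-- The exceptional ideal in a chart: if `φ(c_k) = φ(cᵢ) · uf_k` for all `k`, then `(φ cᵢ) = φ((c))`. [folklore] -/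
theorem span_singleton_eq_map_span_of_rel {S : Type u} [CommRing S] (φ : R →+* S) {n : ℕ} (c : Fin n → R) (i : Fin n) (uf : Fin n → S)
    (hrel : ∀ k, φ (c k) = φ (c i) * uf k) : Ideal.span {φ (c i)} = (Ideal.span (Set.range c)).map φ := by
  apply le_antisymm
  · rw [Ideal.span_le, Set.singleton_subset_iff]
    exact Ideal.mem_map_of_mem φ (Ideal.subset_span ⟨i, rfl⟩)
  · rw [Ideal.map_span, Ideal.span_le]
    rintro _ ⟨_, ⟨k, rfl⟩, rfl⟩
    rw [SetLike.mem_coe, hrel k]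
    exact Ideal.mul_mem_right _ _ (Ideal.mem_span_singleton_self _)

/-- In a domain, `(e · f) = (e)` with `e ≠ 0` forces `f` to be a unit. [folklore] -/
theorem isUnit_of_span_singleton_mul_eq [IsDomain R] {e f : R} (he : e ≠ 0) (h : Ideal.span {e * f} = Ideal.span {e}) : IsUnit f := by
  have hmem : e ∈ Ideal.span {e * f} := h ▸ Ideal.mem_span_singleton_self e
  obtain ⟨r, hr⟩ := Ideal.mem_span_singleton'.mp hmem
  have h1 : e * (f * r) = e * 1 := by
    rw [mul_one]
    calc e * (f * r) = r * (e * f) := by ring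
      _ = e := hr
  exact isUnit_iff_exists_inv.mpr ⟨r, mul_left_cancel₀ he h1⟩

end Plumbing

/-- **Point centres have no `w`-block**: if `(c, w)` is a regular system of parameters with `(c) = 𝔪`, then `l = 0`. [cite: Matsumura1987, Thm. 14.2] -/
theorem eq_zero_of_span_centre_eq_maximalIdeal {R : Type u} [CommRing R] [IsLocalRing R] (hR : IsRegularLocalRing R) {n l : ℕ}
    (c : Fin n → R) (w : Fin l → R) (hz : Ideal.span (Set.range (Fin.append c w)) = maximalIdeal R)
    (hdim : ringKrullDim R = ((n + l : ℕ) : WithBot ℕ∞)) (hc : Ideal.span (Set.range c) = maximalIdeal R) : l = 0 := by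
  rcases Nat.eq_zero_or_pos l with h | h
  · exact h
  · exfalso
    have hrsop := isRsopPart_append_of_span_range_append hR c w hz hdim
    have h1 := append_right_not_mem_span_sup_sq hrsop ⟨0, h⟩
    apply h1
    rw [hc]
    have hw : w ⟨0, h⟩ ∈ maximalIdeal R := by
      have h2 := hrsop.mem_maximalIdeal (Fin.natAdd n ⟨0, h⟩)
      rwa [Fin.append_right] at h2
    exact Ideal.mem_sup_left hw

/-! ## §1 The common reduction: the transform at `x'` when no side other than a given one passes -/

section Scheme

variable {p : ℕ} {X X' : Scheme.{u}} [IsIntegral X] [IsIntegral X'] {τ : X' ⟶ X} [IsDominant τ]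
  {J : X.IdealSheafData}

/-- Representatives pull back along `τ^♯ : K(X) → K(X')` (non-triviality is kept since `τ^♯` is injective). [folklore] -/
theorem rep_functionFieldMap (x' : X') {G : X.functionField} {cc : Fin p → X.functionField} (hcc : ∃ j : Fin p, (j : ℕ) ≠ 0 ∧ cc j ≠ 0)
    {X₀ : X.presheaf.stalk (τ x')} (hrep : (∑ j : Fin p, cc j ^ p * G ^ (j : ℕ)) = RatFn.toFunctionField (τ x') X₀) :
    (∃ j : Fin p, (j : ℕ) ≠ 0 ∧ RatFn.functionFieldMap τ (cc j) ≠ 0) ∧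
      (∑ j : Fin p, RatFn.functionFieldMap τ (cc j) ^ p * RatFn.functionFieldMap τ G ^ (j : ℕ)) =
        RatFn.toFunctionField x' ((τ.stalkMap x').hom X₀) := by
  refine ⟨?_, ?_⟩
  · obtain ⟨j, hj, hcj⟩ := hcc
    exact ⟨j, hj, (map_ne_zero _).mpr hcj⟩
  · have h1 : (∑ j : Fin p, RatFn.functionFieldMap τ (cc j) ^ p * RatFn.functionFieldMap τ G ^ (j : ℕ)) =
        RatFn.functionFieldMap τ (∑ j : Fin p, cc j ^ p * G ^ (j : ℕ)) := by
      simp only [map_sum, map_mul, map_pow]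
    rw [h1, hrep, RatFn.functionFieldMap_toFunctionField]

/-! ## §2 No clean side through the point -/

/-- **Charged exceptional plane, no side through `x'`: every regular curve germ of the exceptional divisor through `x'` is clean-permissible.**
`τ : X' → X` a blowing up along `J`, the line of `G` clean-permissible at `x = τ x'` for `J_x` in form (1) (`(c, w)`, `u`, `a`, `b` with `b = 0`),
no clean side `V(c_k)` (`a_k ≠ 0`) through `x'`, `p ∤ Σ a_k`, `dim 𝒪_{X',x'} = 3`; then for every `N = (e', z)` with `(e') = J_x 𝒪_{X',x'}` and
`(e', z, z')` a regular system of parameters, the line of `τ^♯ G` is clean-permissible at `x'` for `N` (memo 4e §2.4 (B1): no births in a charged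
plane). [cite: Piltant2013, §2 Axiom 4] [cite: CossartPiltant2008, Lemma 4.3 (5)] -/
theorem cleanPermissibleAt_exceptionalCurve_of_not_dvd [Fact p.Prime] (hτ : IsBlowup τ J) (x' : X')
    (hR : IsRegularLocalRing (X.presheaf.stalk (τ x'))) {n l : ℕ} (c : Fin n → X.presheaf.stalk (τ x'))
    (w : Fin l → X.presheaf.stalk (τ x')) (hz : Ideal.span (Set.range (Fin.append c w)) = maximalIdeal (X.presheaf.stalk (τ x')))
    (hdim : ringKrullDim (X.presheaf.stalk (τ x')) = ((n + l : ℕ) : WithBot ℕ∞))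
    (hcJ : Ideal.span (Set.range c) = stalkIdeal J (τ x'))
    {G : X.functionField} {cc : Fin p → X.functionField} (hcc : ∃ j : Fin p, (j : ℕ) ≠ 0 ∧ cc j ≠ 0)
    {u : X.presheaf.stalk (τ x')} (hu : IsUnit u) {a : Fin n → ℕ} {b : Fin l → ℕ}
    (hrep : (∑ j : Fin p, cc j ^ p * G ^ (j : ℕ)) = RatFn.toFunctionField (τ x') (u * (∏ k, c k ^ a k) * ∏ m, w m ^ b m))
    (hb : ∀ m, b m = 0)
    (hsides : ∀ k, a k ≠ 0 → Ideal.span {(τ.stalkMap x').hom (c k)} = (stalkIdeal J (τ x')).map (τ.stalkMap x').hom)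
    (hA : ¬ p ∣ ∑ k, a k)
    (hdim' : ringKrullDim (X'.presheaf.stalk x') = 3) {e' z z' : X'.presheaf.stalk x'}
    (he' : Ideal.span {e'} = (stalkIdeal J (τ x')).map (τ.stalkMap x').hom)
    (hzz : Ideal.span ({e', z, z'} : Set (X'.presheaf.stalk x')) = maximalIdeal (X'.presheaf.stalk x')) :
    CleanPermissibleAt p (RatFn.toFunctionField x') (RatFn.functionFieldMap τ G) (Ideal.span ({e', z} : Set (X'.presheaf.stalk x'))) := by
  classical
  obtain ⟨i, uf, m, jJ, hrel, -, -, hch, -, hrsop, U, hU, -, heq⟩ :=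
    exists_transform_normalForm_of_isBlowup hτ x' hR c w hz hdim hcJ a b hu
  have hR' : IsRegularLocalRing (X'.presheaf.stalk x') := hrsop.isRegularLocalRing
  haveI := isDomain_of_isRegularLocalRing (X'.presheaf.stalk x')
  have hei : (τ.stalkMap x').hom (c i) ≠ 0 := by simpa using hrsop.ne_zero 0
  have hE : Ideal.span {(τ.stalkMap x').hom (c i)} = (stalkIdeal J (τ x')).map (τ.stalkMap x').hom := by
    rw [← hcJ]; exact span_singleton_eq_map_span_of_rel _ c i uf hrel
  obtain ⟨v, hv⟩ : Associated e' ((τ.stalkMap x').hom (c i)) := Ideal.span_singleton_eq_span_singleton.mp (he'.trans hE.symm)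
  -- no charged side carries an exponent
  have ha0 : ∀ q, a (jJ q).1 = 0 := by
    intro q
    by_contra hne
    have hspan := hsides _ hne
    rw [← hE, hrel] at hspan
    exact mem_nonunits_iff.mp ((mem_maximalIdeal _).mp (hch q)) (isUnit_of_span_singleton_mul_eq hei hspan)
  have hprod1 : ∏ q, uf (jJ q).1 ^ a (jJ q).1 = 1 := Finset.prod_eq_one fun q _ => by rw [ha0 q, pow_zero]
  have hprod2 : ∏ m', (τ.stalkMap x').hom (w m') ^ b m' = 1 := Finset.prod_eq_one fun m' _ => by rw [hb m', pow_zero]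
  have heq' : (τ.stalkMap x').hom (u * (∏ k, c k ^ a k) * ∏ m', w m' ^ b m') = (U * ↑v ^ (∑ k, a k)) * e' ^ (∑ k, a k) := by
    rw [heq, hprod1, hprod2, mul_one, mul_one, ← hv, mul_pow]; ring
  obtain ⟨hcc', hrep'⟩ := rep_functionFieldMap x' hcc hrep
  rw [heq'] at hrep'
  exact cleanPermissibleAt_exceptional_of_not_dvd (RatFn.toFunctionField x') hR' hdim' hzz _ hcc' (hU.mul ((Units.isUnit v).pow _)) hA
    hrep'

/-- **No side through `x'`, any exponent sum: clean-permissible unless `x'` is a birth** (memo 4e §2.4 (B2)/(B5)).  Same setting without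
`p ∤ Σ a_k`; the transform is `U · e'^A` for a unit `U` of `𝒪_{X',x'}`, and `N = (e', z)` is clean-permissible as soon as, for every such presentation,
`x'` is not a birth of `N`: `Ū ∉ κ(x')^p`, or some `U - c'^p ∈ 𝔪` is transversal to `N`, or some `U - c'^p` is a minimal generator of `N`
(✓ `cleanPermissibleAt_of_unit_rep`). [cite: Piltant2013, §2 Axiom 4] [cite: CossartPiltant2008, Lemma 4.3 (5)] -/
theorem cleanPermissibleAt_exceptionalCurve_of_nonbirth [Fact p.Prime] [CharP X'.functionField p] (hτ : IsBlowup τ J) (x' : X')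
    (hR : IsRegularLocalRing (X.presheaf.stalk (τ x'))) {n l : ℕ} (c : Fin n → X.presheaf.stalk (τ x'))
    (w : Fin l → X.presheaf.stalk (τ x')) (hz : Ideal.span (Set.range (Fin.append c w)) = maximalIdeal (X.presheaf.stalk (τ x')))
    (hdim : ringKrullDim (X.presheaf.stalk (τ x')) = ((n + l : ℕ) : WithBot ℕ∞))
    (hcJ : Ideal.span (Set.range c) = stalkIdeal J (τ x'))
    {G : X.functionField} {cc : Fin p → X.functionField} (hcc : ∃ j : Fin p, (j : ℕ) ≠ 0 ∧ cc j ≠ 0)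
    {u : X.presheaf.stalk (τ x')} (hu : IsUnit u) {a : Fin n → ℕ} {b : Fin l → ℕ}
    (hrep : (∑ j : Fin p, cc j ^ p * G ^ (j : ℕ)) = RatFn.toFunctionField (τ x') (u * (∏ k, c k ^ a k) * ∏ m, w m ^ b m))
    (hb : ∀ m, b m = 0)
    (hsides : ∀ k, a k ≠ 0 → Ideal.span {(τ.stalkMap x').hom (c k)} = (stalkIdeal J (τ x')).map (τ.stalkMap x').hom)
    (hdim' : ringKrullDim (X'.presheaf.stalk x') = 3) {e' z z' : X'.presheaf.stalk x'}
    (he' : Ideal.span {e'} = (stalkIdeal J (τ x')).map (τ.stalkMap x').hom)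
    (hzz : Ideal.span ({e', z, z'} : Set (X'.presheaf.stalk x')) = maximalIdeal (X'.presheaf.stalk x'))
    (hbirth : ∀ U : X'.presheaf.stalk x', IsUnit U →
      (∑ j : Fin p, RatFn.functionFieldMap τ (cc j) ^ p * RatFn.functionFieldMap τ G ^ (j : ℕ)) =
        RatFn.toFunctionField x' (U * e' ^ (∑ k, a k)) →
      (∀ c' : X'.presheaf.stalk x', U - c' ^ p ∉ maximalIdeal (X'.presheaf.stalk x')) ∨
      (∃ c' : X'.presheaf.stalk x', U - c' ^ p ∈ maximalIdeal (X'.presheaf.stalk x') ∧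
        U - c' ^ p ∉ Ideal.span ({e', z} : Set (X'.presheaf.stalk x')) ⊔ maximalIdeal (X'.presheaf.stalk x') ^ 2) ∨
      (∃ c' : X'.presheaf.stalk x', U - c' ^ p ∈ Ideal.span ({e', z} : Set (X'.presheaf.stalk x')) ∧
        U - c' ^ p ∉ maximalIdeal (X'.presheaf.stalk x') ^ 2)) :
    CleanPermissibleAt p (RatFn.toFunctionField x') (RatFn.functionFieldMap τ G) (Ideal.span ({e', z} : Set (X'.presheaf.stalk x'))) := by
  classical
  by_cases hA : p ∣ ∑ k, a k
  swap
  · exact cleanPermissibleAt_exceptionalCurve_of_not_dvd hτ x' hR c w hz hdim hcJ hcc hu hrep hb hsides hA hdim' he' hzz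
  obtain ⟨i, uf, m, jJ, hrel, -, -, hch, -, hrsop, U, hU, -, heq⟩ :=
    exists_transform_normalForm_of_isBlowup hτ x' hR c w hz hdim hcJ a b hu
  have hR' : IsRegularLocalRing (X'.presheaf.stalk x') := hrsop.isRegularLocalRing
  haveI := isDomain_of_isRegularLocalRing (X'.presheaf.stalk x')
  have hei : (τ.stalkMap x').hom (c i) ≠ 0 := by simpa using hrsop.ne_zero 0
  have hE : Ideal.span {(τ.stalkMap x').hom (c i)} = (stalkIdeal J (τ x')).map (τ.stalkMap x').hom := by
    rw [← hcJ]; exact span_singleton_eq_map_span_of_rel _ c i uf hrel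
  obtain ⟨v, hv⟩ : Associated e' ((τ.stalkMap x').hom (c i)) := Ideal.span_singleton_eq_span_singleton.mp (he'.trans hE.symm)
  have he'0 : e' ≠ 0 := left_ne_zero_of_mul (hv.symm ▸ hei)
  have ha0 : ∀ q, a (jJ q).1 = 0 := by
    intro q
    by_contra hne
    have hspan := hsides _ hne
    rw [← hE, hrel] at hspan
    exact mem_nonunits_iff.mp ((mem_maximalIdeal _).mp (hch q)) (isUnit_of_span_singleton_mul_eq hei hspan)
  have hprod1 : ∏ q, uf (jJ q).1 ^ a (jJ q).1 = 1 := Finset.prod_eq_one fun q _ => by rw [ha0 q, pow_zero]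
  have hprod2 : ∏ m', (τ.stalkMap x').hom (w m') ^ b m' = 1 := Finset.prod_eq_one fun m' _ => by rw [hb m', pow_zero]
  have heq' : (τ.stalkMap x').hom (u * (∏ k, c k ^ a k) * ∏ m', w m' ^ b m') = (U * ↑v ^ (∑ k, a k)) * e' ^ (∑ k, a k) := by
    rw [heq, hprod1, hprod2, mul_one, mul_one, ← hv, mul_pow]; ring
  obtain ⟨hcc', hrep'⟩ := rep_functionFieldMap x' hcc hrep
  rw [heq'] at hrep'
  have hU' : IsUnit (U * ↑v ^ (∑ k, a k)) := hU.mul ((Units.isUnit v).pow _)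
  have hrepU := rep_eq_mul_pow_of_dvd (RatFn.toFunctionField x') (fun j => RatFn.functionFieldMap τ (cc j)) hA hrep'
  have hd : RatFn.toFunctionField x' e' ^ ((∑ k, a k) / p) ≠ 0 :=
    pow_ne_zero _ ((map_ne_zero_iff _ (RatFn.toFunctionField_injective x')).mpr he'0)
  exact cleanPermissibleAt_of_unit_rep (RatFn.toFunctionField x') hR' hdim' hzz _ hcc' hU' hd hrepU (hbirth _ hU' hrep')

end Scheme

end Summit.ResolutionOfSingularities.ResolutionOfSingularities.Theorems.RadicialJung.CleanModels

end
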